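import Mathlib
import Literature.AlgebraicGeometry.HodgeTheory.FermatShiodaCondition
import Summits.HodgeConjecture.FermatCycles.HodgeFermatLemmaWFourier
import Summits.HodgeConjecture.FermatCycles.HodgeFermatHypUPlusA
import Summits.HodgeConjecture.FermatCycles.HodgeFermatTheoremUEq

/-!
# COROLLARY U′, COROLLARY U♯ (printed thresholds) and THEOREM U in shared-entry form — the STATEMENTS (count-neutral; HF-G27/27b/27c)

Cell `pub-hfermat` (tree path `Summits/HodgeConjecture/FermatCycles/`), seat prover-1 gen-5, acting on the COORDINATOR KEEPER
RULING of 2026-08-25 (gem sweep H1: take the sibling package's off-gate kernel theorems through the normal gate, statement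
first).  Three gate records of the sibling cell's standalone package `run/shared/lean/pub/pub-hodgefermat/lean/HodgeFermat/`
were never put through the gate: GATE HF-G27 (pub-hodgefermat `CERT.md` l.912: COROLLARY U′ with threshold 6,
`CorollaryUPrime.lean` sha256 `e1ce3070c5d6fd4e…` / `CorollaryUPrimeFinal.lean` `3bb9706677408c29…`, and «every all-unit
Hodge quadruple at every odd level is two pairs», `QuadEnum.lean` `ea32ed006ed70f9d…`), GATE HF-G27b (`CERT.md` l.915: COROLLARY U′
with the PRINTED thresholds `1/s(N)`, `1/U(N)`, `LemmaWk.lean` `c23397a320584cc1…` / `LemmaWkFourier.lean` `b78eba07b2a58ffb…` /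
`BadCountBound.lean` `185638304fc319ed…` / `CorollaryUSharp.lean` `fc65dc100004b6ff…` / `CorollaryUSharpFinal.lean` `b476eebb06864705…`)
and GATE HF-G27c (`CERT.md` l.918: THEOREM U in SHARED-ENTRY form at every odd level, `TheoremUShared.lean` `f94b78ba2a5b2cab…` /
`TheoremUSharedFinal.lean` `127c91862488a521…`; cell records `check/CorUPrime_standalone.lean`, `check/QuadEnum_standalone.lean`,
`check/LemmaWk_standalone.lean`, `check/CorUSharp_standalone.lean`, `check/BadCountBound_standalone.lean`, `check/ThmUShared_standalone.lean` and
their link checks, all hub `lean check` rc 0).  This file files the STATEMENTS first — the `Prop`-valued definitions of the three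
closing theorems, byte-identical to their source lines, in their own namespaces, and nothing else:
  * `HodgeFermat.KRFree.CorollaryUPrime.IsSumOfPairs` / `CorUPrime` (`CorollaryUPrime.lean` l.58–66): **COROLLARY U′** — at every odd
    level `N ∉ {21, 39}` a Hodge multiset over `ℤ/N` (tree predicate `Literature.AlgebraicGeometry.HodgeTheory.FermatCharacter.
    IsHodgeMultiset`: non-zero entries, zero sum, Shioda's length condition at every unit) all of whose entries are UNITS and which
    has at most six distinct entries is a sum of pairs `{a, −a}` (hence, for the Fermat variety, a sum of classes of linear
    subspaces — ℤ-reachable from the printed supply; no claim on general Hodge is made or implied here);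
  * `HodgeFermat.KRFree.CorollaryUSharp.CorUSharpS` / `CorUSharpU` (`CorollaryUSharpFinal.lean` l.79–87): **COROLLARY U♯** — the same at
    EVERY odd level with at most `k` distinct entries under the printed thresholds `2·k·#bad(N) < φ(N)` (`k < 1/s(N)`;
    `LemmaWFourier.badCount`, landed) resp. `k · Σ_{p ∣ N} τ⁺(N, p) < φ(N)` (`k < 1/U(N)`; `HypUPlus.tauP`, landed);
  * `HodgeFermat.KRFree.TheoremUShared.SharedEqAt` / `ThmUShared` / `ThmUSharedMultiset` (`TheoremUShared.lean` l.35–56): **THEOREM U,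
    shared-entry form** — at EVERY odd level (21 and 39 included) two all-unit zero-sum triples with the same CM type
    (`LemmaN.SameType`, landed) and a common entry are permutations of each other mod `N` (`TheoremUEq.Perm3`, landed).
The proofs follow, verbatim, in `HodgeFermatCorollaryUPrime.lean` / `HodgeFermatCorollaryUPrimeFinal.lean` (`corUPrime : CorUPrime`,
`quadruple_odd`), `HodgeFermatCorollaryUSharp.lean` / `HodgeFermatCorollaryUSharpFinal.lean` (`corUSharpS`, `corUSharpU`) and
`HodgeFermatTheoremUShared.lean` (`thmUShared`, `thmUSharedMultiset`), over `HodgeFermatLattice.lean`, `HodgeFermatQuadEnum.lean`,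
`HodgeFermatLemmaWk.lean` (pub-hodgefermat `tables/SEMI-THEOREM.md` §2–§3; paper §1 (xiv)).

Deviations from the source lines: the `import` lines; this docstring; the `open` lines are the sources' restricted to the names the
definitions use (`(IsHodgeMultiset)`, `(badCount)`, `(tauP)`, `(IsSumOfPairs)`, `(SameType)`, `(Perm3)`), since the proof-side
namespaces they also open do not exist yet at this point of the import graph.  The seven definitions and their docstrings are
byte-identical to the source lines named above.

HONEST FRAMING: explicit algebraic cycles for specific Hodge classes on Fermat/Delsarte varieties; residual open instances
listed; no claim on general Hodge.  No `sorry`; seven `Prop`-valued definitions (count-neutral).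
-/

set_option autoImplicit false

-- ════════════════════════════════════════════════════════════════════════════════════════════════
-- statements of HodgeFermat/CorollaryUPrime.lean (source lines 58–66)
-- ════════════════════════════════════════════════════════════════════════════════════════════════

namespace HodgeFermat.KRFree.CorollaryUPrime

open Literature.AlgebraicGeometry.HodgeTheory.FermatCharacter (IsHodgeMultiset)

/-- `s` is a sum of pairs `{a, −a}` of non-zero residues. -/
def IsSumOfPairs {N : ℕ} (s : Multiset (ZMod N)) : Prop :=
  ∃ P : Multiset (ZMod N), (∀ a ∈ P, a ≠ 0) ∧ s = (P.map fun a => ({a, -a} : Multiset (ZMod N))).sum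

/-- **COROLLARY U′**: at every ODD level `N ∉ {21, 39}`, a Hodge multiset over `ℤ/N` all of whose entries are units
and which has at most six distinct entries is a sum of pairs `{a, −a}`. -/
def CorUPrime : Prop :=
  ∀ N : ℕ, ¬ 2 ∣ N → N ≠ 21 → N ≠ 39 → ∀ s : Multiset (ZMod N),
    IsHodgeMultiset s → (∀ a ∈ s, IsUnit a) → s.toFinset.card ≤ 6 → IsSumOfPairs s

end HodgeFermat.KRFree.CorollaryUPrime

-- ════════════════════════════════════════════════════════════════════════════════════════════════
-- statements of HodgeFermat/CorollaryUSharpFinal.lean (source lines 79–87)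
-- ════════════════════════════════════════════════════════════════════════════════════════════════

namespace HodgeFermat.KRFree.CorollaryUSharp

open HodgeFermat.KRFree.LemmaWFourier (badCount)
open HodgeFermat.KRFree.HypUPlus (tauP)
open HodgeFermat.KRFree.CorollaryUPrime (IsSumOfPairs)
open Literature.AlgebraicGeometry.HodgeTheory.FermatCharacter (IsHodgeMultiset)

/-- COROLLARY U′ with threshold `1/s(N)`: `#supp < 1/s(N)` ⟹ sum of pairs, at every odd level. -/
def CorUSharpS : Prop :=
  ∀ N k : ℕ, ¬ 2 ∣ N → 2 * k * badCount N < N.totient → ∀ s : Multiset (ZMod N),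
    IsHodgeMultiset s → (∀ a ∈ s, IsUnit a) → s.toFinset.card ≤ k → IsSumOfPairs s

/-- COROLLARY U′ with threshold `1/U(N)`: `#supp < 1/U(N)` ⟹ sum of pairs, at every odd level. -/
def CorUSharpU : Prop :=
  ∀ N k : ℕ, ¬ 2 ∣ N → k * ∑ p ∈ N.primeFactors, tauP N p < N.totient → ∀ s : Multiset (ZMod N),
    IsHodgeMultiset s → (∀ a ∈ s, IsUnit a) → s.toFinset.card ≤ k → IsSumOfPairs s

end HodgeFermat.KRFree.CorollaryUSharp

-- ════════════════════════════════════════════════════════════════════════════════════════════════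
-- statements of HodgeFermat/TheoremUShared.lean (source lines 35–56)
-- ════════════════════════════════════════════════════════════════════════════════════════════════

namespace HodgeFermat.KRFree.TheoremUShared

open HodgeFermat.KRFree.LemmaN (SameType)
open HodgeFermat.KRFree.TheoremUEq (Perm3)

/-- THEOREM U in its SHARED-ENTRY form at ONE level `N`: two all-unit triples of level `N` with the same CM type and a
common first entry (`a ≡ a' (mod N)`) are permutations of each other as residues mod `N`. -/
def SharedEqAt (N : ℕ) : Prop :=
  ∀ a b c a' b' c' : ℕ,
    N ∣ a + b + c → N ∣ a' + b' + c' →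
    Nat.Coprime a N → Nat.Coprime b N → Nat.Coprime c N →
    Nat.Coprime a' N → Nat.Coprime b' N → Nat.Coprime c' N →
    SameType N (a, b, c) (a', b', c') → a % N = a' % N →
    Perm3 (a % N) (b % N) (c % N) (a' % N) (b' % N) (c' % N)

/-- **THEOREM U, shared-entry form, at EVERY odd level** (no exception). -/
def ThmUShared : Prop := ∀ N : ℕ, ¬ 2 ∣ N → SharedEqAt N

/-- … as an equality of multisets in `ℤ/N`. -/
def ThmUSharedMultiset : Prop :=
  ∀ N a b c a' b' c' : ℕ, ¬ 2 ∣ N →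
    N ∣ a + b + c → N ∣ a' + b' + c' →
    Nat.Coprime a N → Nat.Coprime b N → Nat.Coprime c N →
    Nat.Coprime a' N → Nat.Coprime b' N → Nat.Coprime c' N →
    SameType N (a, b, c) (a', b', c') → a % N = a' % N →
    ({(a : ZMod N), (b : ZMod N), (c : ZMod N)} : Multiset (ZMod N)) =
      {(a' : ZMod N), (b' : ZMod N), (c' : ZMod N)}

end HodgeFermat.KRFree.TheoremUShared
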